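import Literature.Analysis.Distribution.NormalSymbolDescentFirstOrder
import Literature.Analysis.Distribution.NormalSymbolDescentSecondOrder
import HarnessLib

/-!
# Transport of the normal-symbol descent to linear charts

Topic `Analysis/Distribution`; namespace `Literature.Analysis.Distribution`. The descent theorems
`NormalOrderBelow.vanish_of_firstOrder` (`NormalSymbolDescentFirstOrder`) and
`NormalOrderBelow.vanish_of_secondOrder` (`NormalSymbolDescentSecondOrder`) are stated on a product
`B × Z` with the distinguished subspace `{0} × Z`. Here they are transported along a continuous linear
isomorphism `A : X ≃L[ℝ] B × Z`, and packaged with the finite-order input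
(`exists_nhds_normalOrderBelow` of `NormalFlatVanishing`) into statements about a functional `E` on test
functions on `X`:

* `pushFunctional A E h = E (h ∘ A)`, `pushField A V = A ∘ V ∘ A⁻¹` and the transport identities
  `vecWordDeriv_comp_equiv`, `fieldDerivC_pushField`, `IsLocallyLinearOn.push`, `IsFiniteOrderOn.push`;
* `vanish_near_of_firstOrder`: if `E` is locally linear and of finite order on an open `Wdom ∋ x₀`, satisfies
  first-order equations `E (V_i g) = μ_i E g` whose combination `W = Σ c_i V_i` vanishes on
  `Wdom ∩ A⁻¹({0} × Z)`, has nilpotent normal linearization at `x₀` and `m(x₀) ≠ μ̄(x₀)`, and if `E`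
  vanishes on the test functions supported near `x₀` off `A⁻¹({0} × Z)`, then `E` vanishes near `x₀`;
* `vanish_near_of_secondOrder`: the same with a second-order equation whose normal symbol at `x₀` is
  non-degenerate on some real covector (`qForm … η ≠ 0`);
* `projSplitEquiv`: the splitting `X ≃L range P × ker P` along a continuous idempotent `P` (so that the
  distinguished subspace is `ker P`, `projSplitEquiv_fst_eq_zero_iff`), and the nilpotency of the normal part
  `b ↦ P L b` from that of `P L P` (`isNilpotent_normalPart_of_proj`).

(Hörmander, Thm. 2.3.5 and the invariance of the constructions under linear changes of variables, §6.1.)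
Everything is proved; no named fact is introduced.

## References

* L. Hörmander, *The Analysis of Linear Partial Differential Operators I*, Springer (1983), Thm. 2.3.4,
  Thm. 2.3.5, §6.1. [HormanderALPDO1]
-/

noncomputable section

open Set Filter Function
open scoped Topology ContDiff

namespace Literature.Analysis.Distribution

variable {X : Type*} [NormedAddCommGroup X] [NormedSpace ℝ X]
variable {B Z : Type*} [NormedAddCommGroup B] [NormedSpace ℝ B] [NormedAddCommGroup Z] [NormedSpace ℝ Z]

/-! ### 1. Transport of functionals, fields and derivatives along `A : X ≃L B × Z` -/

section Basic

variable {Y : Type*} [NormedAddCommGroup Y] [NormedSpace ℝ Y]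

/-- **The transported functional** `(A_* E)(h) = E (h ∘ A)`. [folklore] -/
def pushFunctional (A : X ≃L[ℝ] Y) (E : (X → ℂ) → ℂ) : (Y → ℂ) → ℂ := fun h => E (h ∘ A)

/-- **The transported vector field** `A_* V = A ∘ V ∘ A⁻¹`. [folklore] -/
def pushField (A : X ≃L[ℝ] Y) (V : X → X) : Y → Y := fun y => A (V (A.symm y))

/-- Unfolding `pushFunctional`. [folklore] -/
theorem pushFunctional_apply (A : X ≃L[ℝ] Y) (E : (X → ℂ) → ℂ) (h : Y → ℂ) : pushFunctional A E h = E (h ∘ A) := rfl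

/-- Unfolding `pushField`. [folklore] -/
theorem pushField_apply (A : X ≃L[ℝ] Y) (V : X → X) (y : Y) : pushField A V y = A (V (A.symm y)) := rfl

/-- `tsupport (h ∘ A) = A ⁻¹' tsupport h`. [folklore] -/
theorem tsupport_comp_equiv (A : X ≃L[ℝ] Y) (h : Y → ℂ) : tsupport (h ∘ A) = A ⁻¹' tsupport h :=
  tsupport_comp_eq_preimage h A.toHomeomorph

/-- Test functions pull back to test functions. [folklore] -/
theorem IsTestFn.comp_equiv (A : X ≃L[ℝ] Y) {h : Y → ℂ} (hh : IsTestFn h) : IsTestFn (h ∘ A) :=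
  ⟨hh.contDiff.comp A.contDiff, hh.hasCompactSupport.comp_homeomorph A.toHomeomorph⟩

/-- `(g ∘ A⁻¹) ∘ A = g`. [folklore] -/
theorem comp_symm_comp (A : X ≃L[ℝ] Y) (g : X → ℂ) : (g ∘ A.symm) ∘ A = g := by
  funext x; simp

/-- `(h ∘ A) ∘ A⁻¹ = h`. [folklore] -/
theorem comp_comp_symm (A : X ≃L[ℝ] Y) (h : Y → ℂ) : (h ∘ A) ∘ A.symm = h := by
  funext y; simp

/-- **Directional derivatives of a pull-back**: `∂_v (h ∘ A) = (∂_{A v} h) ∘ A`. [folklore] -/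
theorem vecDeriv_comp_equiv (A : X ≃L[ℝ] Y) (v : X) (h : Y → ℂ) :
    vecDeriv v (h ∘ A) = (vecDeriv (A v) h) ∘ A := by
  funext x
  simp only [vecDeriv, Function.comp_apply]
  rw [A.comp_right_fderiv]
  rfl

/-- **Word derivatives of a pull-back**: `∂_w (h ∘ A) = (∂_{A w} h) ∘ A`. [folklore] -/
theorem vecWordDeriv_comp_equiv (A : X ≃L[ℝ] Y) (h : Y → ℂ) :
    ∀ w : List X, vecWordDeriv w (h ∘ A) = (vecWordDeriv (w.map A) h) ∘ A
  | [] => rfl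
  | a :: w => by
    rw [vecWordDeriv_cons, List.map_cons, vecWordDeriv_cons, vecWordDeriv_comp_equiv A h w, vecDeriv_comp_equiv]

/-- **Field derivatives transport**: `(A_* V)(h) = (V (h ∘ A)) ∘ A⁻¹`. [folklore] -/
theorem fieldDerivC_pushField (A : X ≃L[ℝ] Y) (V : X → X) (h : Y → ℂ) :
    fieldDerivC (pushField A V) h = (fieldDerivC V (h ∘ A)) ∘ A.symm := by
  funext y
  simp only [fieldDerivC, Function.comp_apply, pushField_apply]
  rw [A.comp_right_fderiv]
  simp

/-- `(A_* V)(h) ∘ A = V (h ∘ A)`. [folklore] -/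
theorem fieldDerivC_pushField_comp (A : X ≃L[ℝ] Y) (V : X → X) (h : Y → ℂ) :
    (fieldDerivC (pushField A V) h) ∘ A = fieldDerivC V (h ∘ A) := by
  rw [fieldDerivC_pushField]
  exact comp_symm_comp A _

/-- Transported fields are smooth. [folklore] -/
theorem contDiff_pushField (A : X ≃L[ℝ] Y) {V : X → X} (hV : ContDiff ℝ ∞ V) : ContDiff ℝ ∞ (pushField A V) :=
  A.contDiff.comp (hV.comp A.symm.contDiff)

/-- **Local linearity transports.** [folklore] -/
theorem IsLocallyLinearOn.push (A : X ≃L[ℝ] Y) {W : Set X} {E : (X → ℂ) → ℂ} (hE : IsLocallyLinearOn W E) :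
    IsLocallyLinearOn (A.symm ⁻¹' W) (pushFunctional A E) := by
  have hsub : ∀ {h : Y → ℂ}, tsupport h ⊆ A.symm ⁻¹' W → tsupport (h ∘ A) ⊆ W := fun {h} hh => by
    rw [tsupport_comp_equiv]
    intro x hx
    have := hh hx
    simpa using this
  refine ⟨fun f g hf hg hfW hgW => ?_, fun c f hf hfW => ?_⟩
  · simp only [pushFunctional_apply]
    exact hE.add _ _ (hf.comp_equiv A) (hg.comp_equiv A) (hsub hfW) (hsub hgW)
  · simp only [pushFunctional_apply]
    exact hE.smul c _ (hf.comp_equiv A) (hsub hfW)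

/-- **Finite order transports.** [folklore] -/
theorem IsFiniteOrderOn.push (A : X ≃L[ℝ] Y) {W : Set X} {E : (X → ℂ) → ℂ} (hE : IsFiniteOrderOn W E) :
    IsFiniteOrderOn (A.symm ⁻¹' W) (pushFunctional A E) := by
  classical
  intro κ hκ hκW
  have hκ' : IsCompact (A.symm '' κ) := hκ.image A.symm.continuous
  have hκ'W : A.symm '' κ ⊆ W := by
    rintro _ ⟨y, hy, rfl⟩; exact hκW hy
  obtain ⟨C, 𝒮, hC, hb⟩ := hE _ hκ' hκ'W
  refine ⟨C, 𝒮.image (List.map A), hC, fun h hh hhκ M hM => ?_⟩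
  rw [pushFunctional_apply]
  refine hb (h ∘ A) (hh.comp_equiv A) ?_ M fun w hw x => ?_
  · rw [tsupport_comp_equiv]
    intro x hx
    exact ⟨A x, hhκ hx, by simp⟩
  · rw [vecWordDeriv_comp_equiv]
    exact hM (w.map A) (Finset.mem_image_of_mem _ hw) (A x)

end Basic

/-! ### 2. The first-order descent in a linear chart -/

section FirstOrder

variable [FiniteDimensional ℝ B] [FiniteDimensional ℝ Z]
variable {ι : Type*} [Fintype ι]

/-- **First-order descent, transported form.** Let `A : X ≃L B × Z`, `E` a functional on test functions
on `X`, locally linear and of finite order on an open set `Wdom ∋ x₀` with `A x₀ ∈ {0} × Z`; suppose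
`E (V_i g) = μ_i E g` for smooth fields `V_i` (tests supported in `Wdom`), that `W = Σ c_i V_i` vanishes on
`Wdom ∩ A⁻¹({0} × Z)`, that the normal linearization `pr₁ ∘ A ∘ DW(x₀) ∘ A⁻¹ ∘ ι₁` is nilpotent and
`Σ_i V_i(c_i)(x₀) ≠ Σ_i c_i(x₀) μ_i`, and that `E` kills the test functions supported near `x₀` off
`A⁻¹({0} × Z)`. Then `E` vanishes near `x₀`. [cite: HormanderALPDO1, Thm. 2.3.5] -/
theorem vanish_near_of_firstOrder (A : X ≃L[ℝ] (B × Z)) {E : (X → ℂ) → ℂ} {Wdom : Set X}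
    (hlin : IsLocallyLinearOn Wdom E) (hfin : IsFiniteOrderOn Wdom E) (hWo : IsOpen Wdom)
    {Vf : ι → X → X} {c : ι → X → ℝ} {μ : ι → ℂ} (hVf : ∀ i, ContDiff ℝ ∞ (Vf i)) (hc : ∀ i, ContDiff ℝ ∞ (c i))
    (heq : ∀ (i : ι) (g : X → ℂ), IsTestFn g → tsupport g ⊆ Wdom → E (fieldDerivC (Vf i) g) = μ i * E g)
    {x₀ : X} (hx₀ : x₀ ∈ Wdom) (hx₀B : (A x₀).1 = 0)
    (hvanW : ∀ x ∈ Wdom, (A x).1 = 0 → ∑ i, c i x • Vf i x = 0)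
    (hnil : IsNilpotent ((ContinuousLinearMap.fst ℝ B Z).comp ((A : X →L[ℝ] B × Z).comp
      ((fderiv ℝ (fun x => ∑ i, c i x • Vf i x) x₀).comp ((A.symm : B × Z →L[ℝ] X).comp (ContinuousLinearMap.inl ℝ B Z))))))
    (hne : ((∑ i, fderiv ℝ (c i) x₀ (Vf i x₀) : ℝ) : ℂ) ≠ ∑ i, (c i x₀ : ℂ) * μ i)
    (hvanE : ∃ V₀ ∈ 𝓝 x₀, ∀ g : X → ℂ, IsTestFn g → tsupport g ⊆ V₀ → (∀ x ∈ tsupport g, (A x).1 ≠ 0) → E g = 0) :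
    ∃ V' ∈ 𝓝 x₀, ∀ g : X → ℂ, IsTestFn g → tsupport g ⊆ V' → E g = 0 := by
  -- the transported data
  set D : (B × Z → ℂ) → ℂ := pushFunctional A E with hD
  set Wdom' : Set (B × Z) := A.symm ⁻¹' Wdom with hWdom'
  set z₀ : Z := (A x₀).2 with hz₀
  have hAx₀ : A x₀ = ((0 : B), z₀) := Prod.ext hx₀B rfl
  have hx₀' : A.symm ((0 : B), z₀) = x₀ := by rw [← hAx₀, A.symm_apply_apply]
  set Vf' : ι → B × Z → B × Z := fun i => pushField A (Vf i) with hVf'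
  set c' : ι → B × Z → ℝ := fun i => c i ∘ A.symm with hc'
  have hlin' : IsLocallyLinearOn Wdom' D := hlin.push A
  have hfin' : IsFiniteOrderOn Wdom' D := hfin.push A
  have hWo' : IsOpen Wdom' := hWo.preimage A.symm.continuous
  have hVf's : ∀ i, ContDiff ℝ ∞ (Vf' i) := fun i => contDiff_pushField A (hVf i)
  have hc's : ∀ i, ContDiff ℝ ∞ (c' i) := fun i => (hc i).comp A.symm.contDiff
  have hsub : ∀ {h : B × Z → ℂ}, tsupport h ⊆ Wdom' → tsupport (h ∘ A) ⊆ Wdom := fun {h} hh => by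
    rw [tsupport_comp_equiv]; intro x hx
    have h1 : A.symm (A x) ∈ Wdom := hh hx
    simpa using h1
  have heq' : ∀ (i : ι) (h : B × Z → ℂ), IsTestFn h → tsupport h ⊆ Wdom' → D (fieldDerivC (Vf' i) h) = μ i * D h := by
    intro i h hh hhW
    simp only [hD, pushFunctional_apply]
    rw [hVf', fieldDerivC_pushField_comp]
    exact heq i _ (hh.comp_equiv A) (hsub hhW)
  -- the combination `W' = A ∘ W ∘ A⁻¹`
  have htot : ∀ y, totField c' Vf' y = A (∑ i, c i (A.symm y) • Vf i (A.symm y)) := fun y => by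
    simp only [totField, hc', hVf', pushField_apply, Function.comp_apply, map_sum, map_smul]
  have hvan' : ∀ y ∈ Wdom', y.1 = 0 → totField c' Vf' y = 0 := by
    intro y hy hy1
    rw [htot, hvanW _ hy (by simpa using hy1), map_zero]
  -- the normal linearization
  have hWs : ContDiff ℝ ∞ (fun x => ∑ i, c i x • Vf i x) := ContDiff.sum fun i _ => (hc i).smul (hVf i)
  have hnil' : IsNilpotent (normalLinearization (totField c' Vf') z₀) := by
    have h1 : totField c' Vf' = ((A : X → B × Z) ∘ fun x => ∑ i, c i x • Vf i x) ∘ (A.symm : B × Z → X) := by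
      funext y; rw [htot]; rfl
    have hd : DifferentiableAt ℝ (fun x => ∑ i, c i x • Vf i x) x₀ := (hWs.differentiable (by simp)) _
    have h2 : HasFDerivAt ((A : X → B × Z) ∘ fun x => ∑ i, c i x • Vf i x)
        ((A : X →L[ℝ] B × Z).comp (fderiv ℝ (fun x => ∑ i, c i x • Vf i x) x₀)) (A.symm ((0 : B), z₀)) := by
      rw [hx₀']
      exact (A : X →L[ℝ] B × Z).hasFDerivAt.comp x₀ hd.hasFDerivAt
    have h3 : HasFDerivAt (totField c' Vf')
        ((A : X →L[ℝ] B × Z).comp ((fderiv ℝ (fun x => ∑ i, c i x • Vf i x) x₀).comp (A.symm : B × Z →L[ℝ] X)))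
        ((0 : B), z₀) := by
      rw [h1]
      exact h2.comp ((0 : B), z₀) A.symm.hasFDerivAt
    unfold normalLinearization
    rw [h3.fderiv]
    exact hnil
  have hne' : ((multFn c' Vf' ((0 : B), z₀) : ℝ) : ℂ) ≠ eigFn c' μ ((0 : B), z₀) := by
    have hm : multFn c' Vf' ((0 : B), z₀) = ∑ i, fderiv ℝ (c i) x₀ (Vf i x₀) := by
      simp only [multFn, hc', hVf', pushField_apply]
      refine Finset.sum_congr rfl fun i _ => ?_
      rw [A.symm.comp_right_fderiv, hx₀']
      simp
    have he : eigFn c' μ ((0 : B), z₀) = ∑ i, (c i x₀ : ℂ) * μ i := by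
      simp only [eigFn, hc', Function.comp_apply, hx₀']
    rw [hm, he]; exact hne
  -- finite normal order near `(0, z₀)`
  have hvan'' : ∃ V₀ ∈ 𝓝 (((0 : B), z₀) : B × Z), ∀ g : B × Z → ℂ, IsTestFn g → tsupport g ⊆ V₀ →
      (∀ y ∈ tsupport g, y.1 ≠ 0) → D g = 0 := by
    obtain ⟨V₀, hV₀, hV⟩ := hvanE
    refine ⟨A.symm ⁻¹' V₀, ?_, fun g hg hgV hg1 => ?_⟩
    · exact A.symm.continuous.continuousAt.preimage_mem_nhds (by rw [hx₀']; exact hV₀)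
    · simp only [hD, pushFunctional_apply]
      refine hV _ (hg.comp_equiv A) ?_ fun x hx => ?_
      · rw [tsupport_comp_equiv]; intro x hx; simpa using hgV hx
      · rw [tsupport_comp_equiv] at hx
        exact hg1 _ hx
  obtain ⟨V, hV, k, hNO⟩ := exists_nhds_normalOrderBelow hlin'.add hfin' (x₀ := ((0 : B), z₀))
    (by show A.symm ((0 : B), z₀) ∈ Wdom; rw [hx₀']; exact hx₀) hWo' hvan''
  have hNO' : NormalOrderBelow D (V ∩ Wdom') (k + 1) := hNO.mono inter_subset_left
  have hVW : V ∩ Wdom' ∈ 𝓝 (((0 : B), z₀) : B × Z) :=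
    inter_mem hV (hWo'.mem_nhds (by show A.symm ((0 : B), z₀) ∈ Wdom; rw [hx₀']; exact hx₀))
  obtain ⟨V', hV', hD'⟩ := NormalOrderBelow.vanish_of_firstOrder hlin' hVf's hc's heq' subset_rfl hvan' hnil' hne'
    (k + 1) hVW inter_subset_right hNO'
  -- pull back
  refine ⟨A ⁻¹' V', A.continuous.continuousAt.preimage_mem_nhds (by rw [hAx₀]; exact hV'), fun g hg hgV => ?_⟩
  have h := hD' (g ∘ A.symm) (hg.comp_equiv A.symm) (by
    rw [tsupport_comp_equiv]; intro y hy; simpa using hgV hy)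
  simpa [hD, pushFunctional_apply, comp_symm_comp] using h

end FirstOrder

/-! ### 3. The second-order descent in a linear chart -/

section SecondOrder

variable [FiniteDimensional ℝ B] [FiniteDimensional ℝ Z]
variable {κ : Type*} [Fintype κ] {κ' : Type*} [Fintype κ']

/-- **Second-order descent, transported form.** As `vanish_near_of_firstOrder`, for a second-order
equation `E (P g) = λ E g`, `P g = Σ_k a_k V_k (V'_k g) + Σ_l b_l U_l g + c₀ g`, whose normal symbol at `x₀`,
`q(ξ) = Σ_k a_k(x₀) ξ(pr₁ A V_k(x₀)) ξ(pr₁ A V'_k(x₀))`, does not vanish at some real covector `η`.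
[cite: HormanderALPDO1, Thm. 2.3.4, Thm. 2.3.5] -/
theorem vanish_near_of_secondOrder (A : X ≃L[ℝ] (B × Z)) {E : (X → ℂ) → ℂ} {Wdom : Set X}
    (hlin : IsLocallyLinearOn Wdom E) (hfin : IsFiniteOrderOn Wdom E) (hWo : IsOpen Wdom)
    {aC : κ → X → ℂ} {V V' : κ → X → X} {bC : κ' → X → ℂ} {U : κ' → X → X} {c0 : X → ℂ} {lam : ℂ}
    (haC : ∀ k, ContDiff ℝ ∞ (aC k)) (hV : ∀ k, ContDiff ℝ ∞ (V k)) (hV' : ∀ k, ContDiff ℝ ∞ (V' k))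
    (hbC : ∀ l, ContDiff ℝ ∞ (bC l)) (hU : ∀ l, ContDiff ℝ ∞ (U l)) (hc0 : ContDiff ℝ ∞ c0)
    (heq : ∀ g : X → ℂ, IsTestFn g → tsupport g ⊆ Wdom →
      E (∑ k, aC k * fieldDerivC (V k) (fieldDerivC (V' k) g) + ∑ l, bC l * fieldDerivC (U l) g + c0 * g) = lam * E g)
    {x₀ : X} (hx₀ : x₀ ∈ Wdom) (hx₀B : (A x₀).1 = 0) {η : B →L[ℝ] ℝ}
    (hη : qForm (fun k => aC k x₀) (fun k => (A (V k x₀)).1) (fun k => (A (V' k x₀)).1) η ≠ 0)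
    (hvanE : ∃ V₀ ∈ 𝓝 x₀, ∀ g : X → ℂ, IsTestFn g → tsupport g ⊆ V₀ → (∀ x ∈ tsupport g, (A x).1 ≠ 0) → E g = 0) :
    ∃ V₁ ∈ 𝓝 x₀, ∀ g : X → ℂ, IsTestFn g → tsupport g ⊆ V₁ → E g = 0 := by
  set D : (B × Z → ℂ) → ℂ := pushFunctional A E with hD
  set Wdom' : Set (B × Z) := A.symm ⁻¹' Wdom with hWdom'
  set z₀ : Z := (A x₀).2 with hz₀
  have hAx₀ : A x₀ = ((0 : B), z₀) := Prod.ext hx₀B rfl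
  have hx₀' : A.symm ((0 : B), z₀) = x₀ := by rw [← hAx₀, A.symm_apply_apply]
  set Vp : κ → B × Z → B × Z := fun k => pushField A (V k) with hVp
  set Vp' : κ → B × Z → B × Z := fun k => pushField A (V' k) with hVp'
  set Up : κ' → B × Z → B × Z := fun l => pushField A (U l) with hUp
  set aC' : κ → B × Z → ℂ := fun k => aC k ∘ A.symm with haC'
  set bC' : κ' → B × Z → ℂ := fun l => bC l ∘ A.symm with hbC'
  set c0' : B × Z → ℂ := c0 ∘ A.symm with hc0'
  have hlin' : IsLocallyLinearOn Wdom' D := hlin.push A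
  have hfin' : IsFiniteOrderOn Wdom' D := hfin.push A
  have hWo' : IsOpen Wdom' := hWo.preimage A.symm.continuous
  have hsub : ∀ {h : B × Z → ℂ}, tsupport h ⊆ Wdom' → tsupport (h ∘ A) ⊆ Wdom := fun {h} hh => by
    rw [tsupport_comp_equiv]; intro x hx
    have h1 : A.symm (A x) ∈ Wdom := hh hx
    simpa using h1
  -- the transported operator
  have hop : ∀ h : B × Z → ℂ, secondOrderOp aC' Vp Vp' bC' Up c0' h =
      (∑ k, aC k * fieldDerivC (V k) (fieldDerivC (V' k) (h ∘ A)) + ∑ l, bC l * fieldDerivC (U l) (h ∘ A) +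
        c0 * (h ∘ A)) ∘ A.symm := by
    intro h
    have h2 : ∀ k, fieldDerivC (Vp k) (fieldDerivC (Vp' k) h) = (fieldDerivC (V k) (fieldDerivC (V' k) (h ∘ A))) ∘ A.symm := by
      intro k
      rw [hVp, hVp', fieldDerivC_pushField A (V k), fieldDerivC_pushField_comp]
    have h1 : ∀ l, fieldDerivC (Up l) h = (fieldDerivC (U l) (h ∘ A)) ∘ A.symm := fun l => by
      rw [hUp, fieldDerivC_pushField]
    funext y
    simp only [secondOrderOp, h2, h1, haC', hbC', hc0', Finset.sum_apply, Pi.add_apply, Pi.mul_apply,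
      Function.comp_apply, ContinuousLinearEquiv.apply_symm_apply]
  have heq' : ∀ h : B × Z → ℂ, IsTestFn h → tsupport h ⊆ Wdom' → D (secondOrderOp aC' Vp Vp' bC' Up c0' h) = lam * D h := by
    intro h hh hhW
    simp only [hD, pushFunctional_apply]
    rw [hop, comp_symm_comp]
    exact heq _ (hh.comp_equiv A) (hsub hhW)
  have hη' : qForm (fun k => aC' k ((0 : B), z₀)) (fun k => (Vp k ((0 : B), z₀)).1) (fun k => (Vp' k ((0 : B), z₀)).1) η ≠ 0 := by
    simp only [haC', hVp, hVp', pushField_apply, Function.comp_apply, hx₀']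
    exact hη
  have hvan'' : ∃ V₀ ∈ 𝓝 (((0 : B), z₀) : B × Z), ∀ g : B × Z → ℂ, IsTestFn g → tsupport g ⊆ V₀ →
      (∀ y ∈ tsupport g, y.1 ≠ 0) → D g = 0 := by
    obtain ⟨V₀, hV₀, hV0⟩ := hvanE
    refine ⟨A.symm ⁻¹' V₀, ?_, fun g hg hgV hg1 => ?_⟩
    · exact A.symm.continuous.continuousAt.preimage_mem_nhds (by rw [hx₀']; exact hV₀)
    · simp only [hD, pushFunctional_apply]
      refine hV0 _ (hg.comp_equiv A) ?_ fun x hx => ?_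
      · rw [tsupport_comp_equiv]; intro x hx; simpa using hgV hx
      · rw [tsupport_comp_equiv] at hx
        exact hg1 _ hx
  obtain ⟨V₀, hV₀, k, hNO⟩ := exists_nhds_normalOrderBelow hlin'.add hfin' (x₀ := ((0 : B), z₀))
    (by show A.symm ((0 : B), z₀) ∈ Wdom; rw [hx₀']; exact hx₀) hWo' hvan''
  have hNO' : NormalOrderBelow D (V₀ ∩ Wdom') (k + 1) := hNO.mono inter_subset_left
  have hVW : V₀ ∩ Wdom' ∈ 𝓝 (((0 : B), z₀) : B × Z) :=
    inter_mem hV₀ (hWo'.mem_nhds (by show A.symm ((0 : B), z₀) ∈ Wdom; rw [hx₀']; exact hx₀))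
  obtain ⟨V₁, hV₁, hD'⟩ := NormalOrderBelow.vanish_of_secondOrder hlin'
    (fun k => (haC k).comp A.symm.contDiff) (fun k => contDiff_pushField A (hV k)) (fun k => contDiff_pushField A (hV' k))
    (fun l => (hbC l).comp A.symm.contDiff) (fun l => contDiff_pushField A (hU l)) (hc0.comp A.symm.contDiff) heq' hη'
    (k + 1) hVW inter_subset_right hNO'
  refine ⟨A ⁻¹' V₁, A.continuous.continuousAt.preimage_mem_nhds (by rw [hAx₀]; exact hV₁), fun g hg hgV => ?_⟩
  have h := hD' (g ∘ A.symm) (hg.comp_equiv A.symm) (by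
    rw [tsupport_comp_equiv]; intro y hy; simpa using hgV hy)
  simpa [hD, pushFunctional_apply, comp_symm_comp] using h

end SecondOrder

/-! ### 4. Splitting a space along a continuous projection -/

section ProjSplit

variable (P : X →L[ℝ] X)

/-- **The splitting `X ≃ range P × ker P` of a continuous idempotent `P`**: `x ↦ (P x, x - P x)`, with inverse
`(y, z) ↦ y + z`. [folklore] -/
def projSplitEquiv (hP : ∀ x, P (P x) = P x) :
    X ≃L[ℝ] (↥(LinearMap.range (P : X →ₗ[ℝ] X)) × ↥(LinearMap.ker (P : X →ₗ[ℝ] X))) where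
  toFun x := (⟨P x, LinearMap.mem_range_self (P : X →ₗ[ℝ] X) x⟩, ⟨x - P x, by
    rw [LinearMap.mem_ker, ContinuousLinearMap.coe_coe, map_sub, hP, sub_self]⟩)
  map_add' x y := by
    ext <;> simp only [map_add, Prod.mk_add_mk, Submodule.coe_add]
    abel
  map_smul' c x := by
    ext <;> simp only [map_smul, RingHom.id_apply, Prod.smul_mk, Submodule.coe_smul, smul_sub]
  invFun yz := (yz.1 : X) + (yz.2 : X)
  left_inv x := by simp
  right_inv := by
    rintro ⟨⟨y, hy⟩, ⟨z, hz⟩⟩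
    obtain ⟨y', rfl⟩ := LinearMap.mem_range.1 hy
    have hz' : P z = 0 := hz
    have hy1 : P (P y') = P y' := hP y'
    ext
    · simp [map_add, hz', hy1]
    · simp [map_add, hz', hy1]
  continuous_toFun := by
    refine Continuous.prodMk ?_ ?_
    · exact (P.continuous).subtype_mk _
    · exact (continuous_id.sub P.continuous).subtype_mk _
  continuous_invFun := by
    exact (continuous_subtype_val.comp continuous_fst).add (continuous_subtype_val.comp continuous_snd)

variable {P}

/-- The first component of the splitting is `P x`. [folklore] -/
@[simp] theorem projSplitEquiv_apply_fst (hP : ∀ x, P (P x) = P x) (x : X) :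
    ((projSplitEquiv P hP x).1 : X) = P x := rfl

/-- The second component of the splitting is `x - P x`. [folklore] -/
@[simp] theorem projSplitEquiv_apply_snd (hP : ∀ x, P (P x) = P x) (x : X) :
    ((projSplitEquiv P hP x).2 : X) = x - P x := rfl

/-- The inverse of the splitting is `(y, z) ↦ y + z`. [folklore] -/
@[simp] theorem projSplitEquiv_symm_apply (hP : ∀ x, P (P x) = P x)
    (yz : ↥(LinearMap.range (P : X →ₗ[ℝ] X)) × ↥(LinearMap.ker (P : X →ₗ[ℝ] X))) :
    (projSplitEquiv P hP).symm yz = (yz.1 : X) + (yz.2 : X) := rfl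

/-- **The distinguished subspace is `ker P`**: `(A x).1 = 0 ↔ P x = 0`. [folklore] -/
theorem projSplitEquiv_fst_eq_zero_iff (hP : ∀ x, P (P x) = P x) (x : X) :
    (projSplitEquiv P hP x).1 = 0 ↔ P x = 0 := by
  rw [← Submodule.coe_eq_zero, projSplitEquiv_apply_fst]

/-- **Nilpotency of the normal part**: if `(P L P)^N = 0` on `X`, then the operator
`pr₁ ∘ A ∘ L ∘ A⁻¹ ∘ ι₁` on `range P` (`A` the splitting) is nilpotent — it is `b ↦ P (L b)`. [folklore] -/
theorem isNilpotent_normalPart_of_proj (hP : ∀ x, P (P x) = P x) (L : X →L[ℝ] X)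
    (hN : IsNilpotent (P.comp (L.comp P))) :
    IsNilpotent ((ContinuousLinearMap.fst ℝ ↥(LinearMap.range (P : X →ₗ[ℝ] X)) ↥(LinearMap.ker (P : X →ₗ[ℝ] X))).comp
      (((projSplitEquiv P hP : X →L[ℝ] _)).comp (L.comp (((projSplitEquiv P hP).symm : _ →L[ℝ] X).comp
        (ContinuousLinearMap.inl ℝ ↥(LinearMap.range (P : X →ₗ[ℝ] X)) ↥(LinearMap.ker (P : X →ₗ[ℝ] X))))))) := by
  obtain ⟨N, hN⟩ := hN
  set Q := (ContinuousLinearMap.fst ℝ ↥(LinearMap.range (P : X →ₗ[ℝ] X)) ↥(LinearMap.ker (P : X →ₗ[ℝ] X))).comp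
      (((projSplitEquiv P hP : X →L[ℝ] _)).comp (L.comp (((projSplitEquiv P hP).symm : _ →L[ℝ] X).comp
        (ContinuousLinearMap.inl ℝ ↥(LinearMap.range (P : X →ₗ[ℝ] X)) ↥(LinearMap.ker (P : X →ₗ[ℝ] X)))))) with hQ
  have hQapply : ∀ b : ↥(LinearMap.range (P : X →ₗ[ℝ] X)), ((Q b : ↥(LinearMap.range (P : X →ₗ[ℝ] X))) : X) = P (L b) := by
    intro b
    simp [hQ]
  have hPb : ∀ b : ↥(LinearMap.range (P : X →ₗ[ℝ] X)), P (b : X) = b := by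
    rintro ⟨b, hb⟩
    obtain ⟨y, rfl⟩ := LinearMap.mem_range.1 hb
    exact hP y
  have key : ∀ (k : ℕ) (b : ↥(LinearMap.range (P : X →ₗ[ℝ] X))),
      (((Q ^ k) b : ↥(LinearMap.range (P : X →ₗ[ℝ] X))) : X) = ((P.comp (L.comp P)) ^ k) (b : X) := by
    intro k
    induction k with
    | zero => intro b; simp
    | succ k ih =>
      intro b
      rw [pow_succ, pow_succ, mul_apply_eq_comp, mul_apply_eq_comp, ih (Q b), hQapply]
      simp only [ContinuousLinearMap.coe_comp, Function.comp_apply]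
      rw [hPb]
  refine ⟨N, ?_⟩
  ext b
  have h := key N b
  rw [hN, zero_apply] at h
  rw [zero_apply, Submodule.coe_zero]
  exact h

end ProjSplit

end Literature.Analysis.Distribution
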